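import Mathlib
import HarnessLib
import Summits.Ventures.LatticeQCDFlow.Scaling.MetricTunnellingSectors
import Summits.Ventures.LatticeQCDFlow.Exactness.TransformedKernel

/-!
# LatticeQCDFlow / Scaling — TUNNELLING LAWS V: the small-step law through a field transformation (latent-space / FTHMC samplers)

HONEST FRAMING: exact (Metropolis-corrected) sampling algorithms for lattice gauge theory;
figures of merit are autocorrelation/cost numbers at stated couplings and volumes; no
continuum-physics claim.

THEORY-2.md §3.3 / §5 (v4.5, theory seat GEN-26, item 118).  `Exactness/TransformedKernel.lean`
proves that an exact update `κ` of LATENT variables `V`, reported through a measurable bijection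
`U = F V` (Lüscher's trivializing-map HMC, field-transformation HMC, "latent-space" flow samplers),
is exact for `F_* μ̃`, and records that "the map can at best change what HMC does for `S̃` versus `S`
… nothing quantitative is claimed".  This file is the quantitative statement for the one figure of
merit the tree prices, the stationary frequency of changes of a topological SECTOR:

* §1 **sectors pull back** (`mapsTo_connectedComponentIn_preimage`, `sectorConstant_comp`): for a
  continuous `F : X → Y` and any defect set `D ⊆ Y`, the latent sector of `x` (component of
  `(F⁻¹ D)ᶜ`) is mapped into the physical sector of `F x` (component of `Dᶜ`); every function
  constant on physical sectors pulls back to one constant on latent sectors.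
* §2 **collars transfer with the Lipschitz constant** (`infEDist_apply_le_mul_infEDist_preimage`,
  `cthickening_preimage_subset`): for a `Λ`-Lipschitz `F` and every `r`,
  `cthickening r (F⁻¹ D) ⊆ F⁻¹ (cthickening (Λ r) D)`.
* §3 **the law through a map** (`compProd_comp_ne_le_two_mul_cthickening_preimage`, `…_of_lipschitz`):
  latent space with `(ρ, r)`-local paths, `κ` a `μ̃`-invariant Markov kernel with a.s. `ρ`-small
  LATENT moves, `Q` constant on the physical sectors:
  `(μ̃ ⊗ₘ κ){Q (F v) ≠ Q (F v')} ≤ 2·μ̃(cthickening r (F⁻¹ D)) ≤ 2·μ̃(F⁻¹ cthickening (Λ r) D)`.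
* §4 **the reported chain** (`compProd_map_conjKernel`): the tunnelling frequency of the REPORTED
  chain `conjKernel κ F` in its stationary law `F_* μ̃` IS that of the latent chain for `Q ∘ F`
  (one Markov chain in two coordinate systems); hence (`conjKernel_sector_ne_le_of_lipschitz`)
  `((F_*μ̃) ⊗ₘ conjKernel κ F){sector ≠ sector'} ≤ 2·(F_*μ̃)(cthickening (Λ r) D)` — the physical
  small-step law with the collar radius multiplied by `Λ = Lip F`, whatever `F` is; when the reported
  chain is exact (`F_* μ̃ = μ`, `invariant_conjKernel` / `thmc_exact`) the right side is
  `2·μ(cthickening (Λ r) D)`.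
* lattice instances (`U(1)` flux charge with the plane collar `planeCollar (4Λρ)`; `SU(N)^E` at
  constant one) are `Scaling/TransformedTunnellingLattice.lean`; the molecular-dynamics (FTHMC) law is
  `Scaling/TransformedMDTunnelling.lean`.

Reading (markdown, THEORY-2.md §3.3 (x)): a field transformation loosens the small-step tunnelling
bound by at most the factor by which it widens the collar, its Lipschitz constant near the defect
set; for a flow map `Λ ≤ e^{K}` with `K` the Lipschitz modulus of the generating field
(`Scaling/FlowLipschitzBudget.lean`, Grönwall), so a gain `G` in the bound needs `K ≥ log G` there.
Everything here is NEW WORK of the cell over Mathlib (elementary); the mechanism — sectors are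
transported by homeomorphisms — is folklore; nearest printed discussion: trivializing maps "may not
resolve topology freezing since the map is a continuous deformation" type remarks in the FTHMC
literature (THEORY-2.md §8 (61) for the search log).  No claim that any `F` attains the loosened bound.
-/

noncomputable section

open scoped ENNReal NNReal
open MeasureTheory ProbabilityTheory Metric Set

namespace Summit.Ventures.LatticeQCDFlow.Theory2.Tunnelling.Transformed

/-! ## §1. Sectors pull back through a continuous map -/

section PullBack

variable {X Y : Type*} [TopologicalSpace X] [TopologicalSpace Y]

/-- **Latent sectors map into physical sectors.**  For a continuous `F` and any `D ⊆ Y`, the connected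
component of `(F⁻¹ D)ᶜ` containing `x ∉ F⁻¹ D` is mapped by `F` into the connected component of `Dᶜ`
containing `F x`. [folklore] -/
theorem mapsTo_connectedComponentIn_preimage {F : X → Y} (hF : Continuous F) (D : Set Y) {x : X}
    (hx : x ∉ F ⁻¹' D) :
    MapsTo F (connectedComponentIn (F ⁻¹' D)ᶜ x) (connectedComponentIn Dᶜ (F x)) := by
  have hpre : IsPreconnected (F '' connectedComponentIn (F ⁻¹' D)ᶜ x) :=
    isPreconnected_connectedComponentIn.image F hF.continuousOn
  have hsub : F '' connectedComponentIn (F ⁻¹' D)ᶜ x ⊆ Dᶜ := by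
    rintro _ ⟨z, hz, rfl⟩ hD
    exact connectedComponentIn_subset _ _ hz hD
  have hmem : F x ∈ F '' connectedComponentIn (F ⁻¹' D)ᶜ x :=
    ⟨x, mem_connectedComponentIn hx, rfl⟩
  intro z hz
  exact hpre.subset_connectedComponentIn hmem hsub ⟨z, hz, rfl⟩

/-- **Sector-constant functions pull back.**  If `Q` is constant on every physical sector (component of
`Dᶜ`), then `Q ∘ F` is constant on every latent sector (component of `(F⁻¹ D)ᶜ`). [folklore] -/
theorem sectorConstant_comp {ι : Sort*} {F : X → Y} (hF : Continuous F) {D : Set Y} {Q : Y → ι}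
    (hQ : ∀ y, y ∉ D → ∀ y' ∈ connectedComponentIn Dᶜ y, Q y' = Q y) :
    ∀ x, x ∉ F ⁻¹' D → ∀ x' ∈ connectedComponentIn (F ⁻¹' D)ᶜ x, Q (F x') = Q (F x) :=
  fun x hx x' hx' => hQ (F x) hx (F x') (mapsTo_connectedComponentIn_preimage hF D hx hx')

/-- The physical sector label itself is constant on latent sectors. [folklore] -/
theorem sector_apply_eq_of_mem_connectedComponentIn {F : X → Y} (hF : Continuous F) (D : Set Y) :
    ∀ x, x ∉ F ⁻¹' D → ∀ x' ∈ connectedComponentIn (F ⁻¹' D)ᶜ x,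
      connectedComponentIn Dᶜ (F x') = connectedComponentIn Dᶜ (F x) :=
  sectorConstant_comp hF (Q := fun y => connectedComponentIn Dᶜ y)
    fun _ _ _ hy' => (connectedComponentIn_eq hy').symm

/-- A function continuous off `D` pulls back to one continuous off `F⁻¹ D`. [folklore] -/
theorem continuousOn_comp_compl_preimage {Z : Type*} [TopologicalSpace Z] {F : X → Y}
    (hF : Continuous F) {D : Set Y} {Q : Y → Z} (hQ : ContinuousOn Q Dᶜ) :
    ContinuousOn (fun x => Q (F x)) (F ⁻¹' D)ᶜ :=
  hQ.comp hF.continuousOn fun _ hx => hx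

end PullBack

/-! ## §2. Collars transfer with the Lipschitz constant -/

section Collar

variable {X Y : Type*} [PseudoEMetricSpace X] [PseudoEMetricSpace Y]

/-- For a `Λ`-Lipschitz `F` with `Λ ≠ 0`: `infEDist (F x) D ≤ Λ · infEDist x (F⁻¹ D)`. [folklore] -/
theorem infEDist_apply_le_mul_infEDist_preimage {F : X → Y} {Λ : ℝ≥0} (hF : LipschitzWith Λ F)
    (hΛ : Λ ≠ 0) (D : Set Y) (x : X) :
    infEDist (F x) D ≤ (Λ : ℝ≥0∞) * infEDist x (F ⁻¹' D) := by
  have key : ∀ z ∈ F ⁻¹' D, infEDist (F x) D ≤ (Λ : ℝ≥0∞) * edist x z := fun z hz =>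
    (infEDist_le_edist_of_mem (show F z ∈ D from hz)).trans (hF x z)
  have h0 : (Λ : ℝ≥0∞) ≠ 0 := ENNReal.coe_ne_zero.2 hΛ
  change infEDist (F x) D ≤ (Λ : ℝ≥0∞) * ⨅ z ∈ F ⁻¹' D, edist x z
  rw [ENNReal.mul_iInf_of_ne h0 ENNReal.coe_ne_top]
  refine le_iInf fun z => ?_
  rw [ENNReal.mul_iInf_of_ne h0 ENNReal.coe_ne_top]
  exact le_iInf fun hz => key z hz

/-- **Collar transfer.**  For a `Λ`-Lipschitz `F`, any `D ⊆ Y` and any `r`: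
`cthickening r (F⁻¹ D) ⊆ F⁻¹ (cthickening (Λ r) D)` — the latent collar of radius `r` about the pulled-back
defect set is mapped into the physical collar of radius `Λ r`. [folklore] -/
theorem cthickening_preimage_subset {F : X → Y} {Λ : ℝ≥0} (hF : LipschitzWith Λ F) (D : Set Y)
    (r : ℝ) : cthickening r (F ⁻¹' D) ⊆ F ⁻¹' cthickening (Λ * r) D := by
  intro x hx
  obtain ⟨z, hz⟩ : (F ⁻¹' D).Nonempty := by
    by_contra h
    rw [not_nonempty_iff_eq_empty] at h
    rw [h, cthickening_empty] at hx
    exact hx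
  rw [mem_cthickening_iff] at hx
  rw [mem_preimage, mem_cthickening_iff, ENNReal.ofReal_mul Λ.coe_nonneg, ENNReal.ofReal_coe_nnreal]
  by_cases hΛ : Λ = 0
  · calc infEDist (F x) D ≤ edist (F x) (F z) := infEDist_le_edist_of_mem (show F z ∈ D from hz)
      _ ≤ (Λ : ℝ≥0∞) * edist x z := hF x z
      _ = 0 := by rw [hΛ, ENNReal.coe_zero, zero_mul]
      _ ≤ _ := bot_le
  · calc infEDist (F x) D ≤ (Λ : ℝ≥0∞) * infEDist x (F ⁻¹' D) :=
          infEDist_apply_le_mul_infEDist_preimage hF hΛ D x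
      _ ≤ (Λ : ℝ≥0∞) * ENNReal.ofReal r := by gcongr

/-- Measure form of the collar transfer: `m (cthickening r (F⁻¹ D)) ≤ m (F⁻¹ cthickening (Λ r) D)`.
[folklore] -/
theorem measure_cthickening_preimage_le {mX : MeasurableSpace X} (m : Measure X) {F : X → Y} {Λ : ℝ≥0}
    (hF : LipschitzWith Λ F) (D : Set Y) (r : ℝ) :
    m (cthickening r (F ⁻¹' D)) ≤ m (F ⁻¹' cthickening (Λ * r) D) :=
  measure_mono (cthickening_preimage_subset hF D r)

end Collar

/-! ## §3. The small-step law through a map -/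

section Laws

variable {X Y : Type*} [PseudoMetricSpace X] [MeasurableSpace X]

omit [MeasurableSpace X] in
/-- **Pathwise separating lemma through a map.**  If a latent move `x → x'` is joined by a path,
continuous on `[0,1]` and inside the closed `ℓ`-ball about `x`, and the physical label `Q ∘ F` changes
(`Q` constant on the components of `Dᶜ`, `F` continuous), then `x ∈ cthickening ℓ (F⁻¹ D)` — the form
used node by node for molecular-dynamics drifts (`Scaling/TransformedMDTunnelling.lean`). [folklore] -/
theorem mem_cthickening_preimage_of_path [TopologicalSpace Y] {ι : Sort*} {D : Set Y} {Q : Y → ι}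
    (hQ : ∀ y, y ∉ D → ∀ y' ∈ connectedComponentIn Dᶜ y, Q y' = Q y) {F : X → Y} (hF : Continuous F)
    {x x' : X} {ℓ : ℝ} {γ : ℝ → X} (hγc : ContinuousOn γ (Icc (0 : ℝ) 1)) (hγ0 : γ 0 = x) (hγ1 : γ 1 = x')
    (hγd : ∀ t ∈ Icc (0 : ℝ) 1, dist (γ t) x ≤ ℓ) (hne : Q (F x) ≠ Q (F x')) :
    x ∈ cthickening ℓ (F ⁻¹' D) := by
  by_contra hx
  have hxD : x ∉ F ⁻¹' D := fun h => hx (self_subset_cthickening _ h)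
  exact hne (sectorConstant_comp hF hQ x hxD x'
    (mem_connectedComponentIn_of_path hγc hγ0 hγ1 hγd hx)).symm

omit [MeasurableSpace X] in
/-- The same through a `Λ`-Lipschitz map, read on the physical side: `F x ∈ cthickening (Λ ℓ) D`.
[folklore] -/
theorem apply_mem_cthickening_of_path [PseudoEMetricSpace Y] {ι : Sort*} {D : Set Y} {Q : Y → ι}
    (hQ : ∀ y, y ∉ D → ∀ y' ∈ connectedComponentIn Dᶜ y, Q y' = Q y) {F : X → Y} {Λ : ℝ≥0}
    (hF : LipschitzWith Λ F) {x x' : X} {ℓ : ℝ} {γ : ℝ → X} (hγc : ContinuousOn γ (Icc (0 : ℝ) 1))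
    (hγ0 : γ 0 = x) (hγ1 : γ 1 = x') (hγd : ∀ t ∈ Icc (0 : ℝ) 1, dist (γ t) x ≤ ℓ)
    (hne : Q (F x) ≠ Q (F x')) : F x ∈ cthickening (Λ * ℓ) D :=
  cthickening_preimage_subset hF D ℓ
    (mem_cthickening_preimage_of_path hQ hF.continuous hγc hγ0 hγ1 hγd hne)

/-- **Small-step law through a continuous map.**  Latent space `X` with `(ρ, r)`-local paths, `F : X → Y`
continuous, `D ⊆ Y` any set, `Q` constant on the components of `Dᶜ`; `μ̃` s-finite, `κ` a `μ̃`-invariant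
Markov kernel on `X` with a.s. `ρ`-small moves.  Then
`(μ̃ ⊗ₘ κ){Q (F v) ≠ Q (F v')} ≤ 2·μ̃(cthickening r (F⁻¹ D))`. [folklore] -/
theorem compProd_comp_ne_le_two_mul_cthickening_preimage [TopologicalSpace Y] {ι : Type*} {D : Set Y}
    {Q : Y → ι} (hQ : ∀ y, y ∉ D → ∀ y' ∈ connectedComponentIn Dᶜ y, Q y' = Q y) {F : X → Y}
    (hF : Continuous F) {ρ r : ℝ}
    (hpath : ∀ x y : X, dist x y ≤ ρ → ∃ γ : ℝ → X, ContinuousOn γ (Icc (0 : ℝ) 1) ∧ γ 0 = x ∧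
      γ 1 = y ∧ ∀ t ∈ Icc (0 : ℝ) 1, dist (γ t) x ≤ r)
    (μ : Measure X) [SFinite μ] (κ : Kernel X X) [IsMarkovKernel κ] (hinv : κ.Invariant μ)
    (hstep : ∀ᵐ p ∂(μ ⊗ₘ κ), dist p.1 p.2 ≤ ρ) :
    (μ ⊗ₘ κ) {p | Q (F p.1) ≠ Q (F p.2)} ≤ 2 * μ (cthickening r (F ⁻¹' D)) :=
  compProd_ne_le_two_mul_cthickening_of_sectorConstant (Q := fun x => Q (F x)) (D := F ⁻¹' D)
    (sectorConstant_comp hF hQ) hpath μ κ hinv hstep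

/-- **Intrinsic form**: the physical SECTOR of the reported configuration changes with stationary
one-step probability `≤ 2·μ̃(cthickening r (F⁻¹ D))`. [folklore] -/
theorem compProd_sector_apply_ne_le_two_mul_cthickening_preimage [TopologicalSpace Y] {D : Set Y}
    {F : X → Y} (hF : Continuous F) {ρ r : ℝ}
    (hpath : ∀ x y : X, dist x y ≤ ρ → ∃ γ : ℝ → X, ContinuousOn γ (Icc (0 : ℝ) 1) ∧ γ 0 = x ∧
      γ 1 = y ∧ ∀ t ∈ Icc (0 : ℝ) 1, dist (γ t) x ≤ r)
    (μ : Measure X) [SFinite μ] (κ : Kernel X X) [IsMarkovKernel κ] (hinv : κ.Invariant μ)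
    (hstep : ∀ᵐ p ∂(μ ⊗ₘ κ), dist p.1 p.2 ≤ ρ) :
    (μ ⊗ₘ κ) {p | connectedComponentIn Dᶜ (F p.1) ≠ connectedComponentIn Dᶜ (F p.2)} ≤
      2 * μ (cthickening r (F ⁻¹' D)) :=
  compProd_ne_le_two_mul_cthickening_of_sectorConstant (Q := fun x => connectedComponentIn Dᶜ (F x))
    (D := F ⁻¹' D) (sector_apply_eq_of_mem_connectedComponentIn hF D) hpath μ κ hinv hstep

/-- **Small-step law through a Lipschitz map.**  As above with `F` `Λ`-Lipschitz (`Y` pseudo-e-metric):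
`(μ̃ ⊗ₘ κ){Q (F v) ≠ Q (F v')} ≤ 2·μ̃(F⁻¹ cthickening (Λ r) D)` — the physical law's collar radius
multiplied by the Lipschitz constant. [folklore] -/
theorem compProd_comp_ne_le_of_lipschitz [PseudoEMetricSpace Y] {ι : Type*} {D : Set Y} {Q : Y → ι}
    (hQ : ∀ y, y ∉ D → ∀ y' ∈ connectedComponentIn Dᶜ y, Q y' = Q y) {F : X → Y} {Λ : ℝ≥0}
    (hF : LipschitzWith Λ F) {ρ r : ℝ}
    (hpath : ∀ x y : X, dist x y ≤ ρ → ∃ γ : ℝ → X, ContinuousOn γ (Icc (0 : ℝ) 1) ∧ γ 0 = x ∧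
      γ 1 = y ∧ ∀ t ∈ Icc (0 : ℝ) 1, dist (γ t) x ≤ r)
    (μ : Measure X) [SFinite μ] (κ : Kernel X X) [IsMarkovKernel κ] (hinv : κ.Invariant μ)
    (hstep : ∀ᵐ p ∂(μ ⊗ₘ κ), dist p.1 p.2 ≤ ρ) :
    (μ ⊗ₘ κ) {p | Q (F p.1) ≠ Q (F p.2)} ≤ 2 * μ (F ⁻¹' cthickening (Λ * r) D) :=
  calc _ ≤ 2 * μ (cthickening r (F ⁻¹' D)) :=
        compProd_comp_ne_le_two_mul_cthickening_preimage hQ hF.continuous hpath μ κ hinv hstep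
    _ ≤ 2 * μ (F ⁻¹' cthickening (Λ * r) D) := by
        gcongr 2 * ?_; exact measure_cthickening_preimage_le μ hF D r

/-- **`n`-step sector persistence through a map**: for a latent process with one-time marginals `m` and
a.s. `ρ`-small steps, the physical sector of `F (Z n)` differs from that of `F (Z 0)` with probability
`≤ n·2·m(cthickening r (F⁻¹ D))`. [folklore] -/
theorem measure_sector_apply_ne_le_nsteps [TopologicalSpace Y] {D : Set Y} {F : X → Y}
    (hF : Continuous F) {ρ r : ℝ}
    (hpath : ∀ x y : X, dist x y ≤ ρ → ∃ γ : ℝ → X, ContinuousOn γ (Icc (0 : ℝ) 1) ∧ γ 0 = x ∧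
      γ 1 = y ∧ ∀ t ∈ Icc (0 : ℝ) 1, dist (γ t) x ≤ r)
    {Ω : Type*} [MeasurableSpace Ω] (P : Measure Ω) (Z : ℕ → Ω → X) (hZ : ∀ k, Measurable (Z k))
    (m : Measure X) (hmarg : ∀ k, P.map (Z k) = m)
    (hstep : ∀ k, ∀ᵐ ω ∂P, dist (Z k ω) (Z (k + 1) ω) ≤ ρ) (n : ℕ) :
    P {ω | connectedComponentIn Dᶜ (F (Z n ω)) ≠ connectedComponentIn Dᶜ (F (Z 0 ω))} ≤
      n * (2 * m (cthickening r (F ⁻¹' D))) := by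
  refine measure_chargeChange_le_nsteps (R := fun _ x y => dist x y ≤ ρ)
    (Q := fun x => connectedComponentIn Dᶜ (F x)) (B := fun _ => cthickening r (F ⁻¹' D))
    (fun _ _ _ hxy hne => Or.inl (mem_cthickening_of_ne_of_sectorConstant
      (sector_apply_eq_of_mem_connectedComponentIn hF D) hpath hxy hne)) P Z hstep (fun k => ?_) n
  have h1 : ∀ j, P (Z j ⁻¹' cthickening r (F ⁻¹' D)) ≤ m (cthickening r (F ⁻¹' D)) := fun j => by
    rw [← hmarg j]; exact Measure.le_map_apply (hZ j).aemeasurable _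
  calc P (Z k ⁻¹' cthickening r (F ⁻¹' D)) + P (Z (k + 1) ⁻¹' cthickening r (F ⁻¹' D))
      ≤ m (cthickening r (F ⁻¹' D)) + m (cthickening r (F ⁻¹' D)) := add_le_add (h1 k) (h1 (k + 1))
    _ = 2 * m (cthickening r (F ⁻¹' D)) := (two_mul _).symm

end Laws

/-! ## §4. The reported chain: one Markov chain in two coordinate systems -/

section Reported

open Summit.Ventures.LatticeQCDFlow.Exactness

variable {X Y : Type*} [MeasurableSpace X] [MeasurableSpace Y]

/-- **Two-time events of the reported chain.**  For a measurable bijection `F`, a Markov kernel `κ` on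
the latent space and an s-finite `ν`: the pair law of the reported chain `conjKernel κ F` started from
`F_* ν` is the image of the latent pair law under `F × F`:
`((F_*ν) ⊗ₘ conjKernel κ F) s = (ν ⊗ₘ κ) ((F × F)⁻¹ s)`. [folklore] -/
theorem compProd_map_conjKernel (κ : Kernel X X) [IsMarkovKernel κ] (ν : Measure X) [SFinite ν]
    (F : X ≃ᵐ Y) {s : Set (Y × Y)} (hs : MeasurableSet s) :
    ((ν.map F) ⊗ₘ conjKernel κ F) s = (ν ⊗ₘ κ) (Prod.map F F ⁻¹' s) := by
  have hs' : MeasurableSet (Prod.map F F ⁻¹' s) := (F.measurable.prodMap F.measurable) hs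
  rw [Measure.compProd_apply hs, Measure.compProd_apply hs', lintegral_map_equiv]
  refine lintegral_congr fun x => ?_
  rw [conjKernel_apply' _ _ _ (measurable_prodMk_left hs), MeasurableEquiv.symm_apply_apply]
  rfl

/-- **Tunnelling frequencies agree.**  The stationary frequency with which the REPORTED chain changes
`Q` is the frequency with which the latent chain changes `Q ∘ F`. [folklore] -/
theorem compProd_map_conjKernel_ne {ι : Type*} [MeasurableSpace ι] [MeasurableEq ι]
    (κ : Kernel X X) [IsMarkovKernel κ] (ν : Measure X) [SFinite ν] (F : X ≃ᵐ Y) {Q : Y → ι}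
    (hQ : Measurable Q) :
    ((ν.map F) ⊗ₘ conjKernel κ F) {q | Q q.1 ≠ Q q.2} = (ν ⊗ₘ κ) {p | Q (F p.1) ≠ Q (F p.2)} := by
  have hs : MeasurableSet {q : Y × Y | Q q.1 ≠ Q q.2} :=
    (measurableSet_eq_fun (hQ.comp measurable_fst) (hQ.comp measurable_snd)).compl
  rw [compProd_map_conjKernel κ ν F hs]
  rfl

variable [PseudoMetricSpace X]

/-- **Small-step law for the reported chain** (any measurable event form).  If the latent tunnelling
event is bounded by `2·μ̃(cthickening r (F⁻¹ D))` — §3 — so is the reported one, whenever the two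
events correspond under `F × F`. Stated for a sector-constant measurable `Q`. [folklore] -/
theorem conjKernel_comp_ne_le [TopologicalSpace Y] {ι : Type*} [MeasurableSpace ι]
    [MeasurableEq ι] {D : Set Y} {Q : Y → ι} (hQm : Measurable Q)
    (hQ : ∀ y, y ∉ D → ∀ y' ∈ connectedComponentIn Dᶜ y, Q y' = Q y) (F : X ≃ᵐ Y)
    (hF : Continuous F) {ρ r : ℝ}
    (hpath : ∀ x y : X, dist x y ≤ ρ → ∃ γ : ℝ → X, ContinuousOn γ (Icc (0 : ℝ) 1) ∧ γ 0 = x ∧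
      γ 1 = y ∧ ∀ t ∈ Icc (0 : ℝ) 1, dist (γ t) x ≤ r)
    (μ : Measure X) [SFinite μ] (κ : Kernel X X) [IsMarkovKernel κ] (hinv : κ.Invariant μ)
    (hstep : ∀ᵐ p ∂(μ ⊗ₘ κ), dist p.1 p.2 ≤ ρ) :
    ((μ.map F) ⊗ₘ conjKernel κ F) {q | Q q.1 ≠ Q q.2} ≤ 2 * μ (cthickening r (F ⁻¹' D)) := by
  rw [compProd_map_conjKernel_ne κ μ F hQm]
  exact compProd_comp_ne_le_two_mul_cthickening_preimage hQ hF hpath μ κ hinv hstep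

/-- **SMALL-STEP TUNNELLING LAW FOR FIELD-TRANSFORMED SAMPLERS.**  Latent space `X` with
`(ρ, r)`-local paths; `F : X ≃ᵐ Y` a `Λ`-Lipschitz measurable bijection onto the physical field space;
`D ⊆ Y` ANY defect set, `Q` measurable and constant on the components of `Dᶜ`; `κ` a `μ̃`-invariant
latent Markov kernel with a.s. `ρ`-small moves; `0 ≤ r`.  Then the reported chain, in its stationary
law `F_* μ̃`, changes `Q` with one-step probability
`≤ 2·(F_* μ̃)(cthickening (Λ r) D)` — the physical small-step law with collar radius `Λ r`.  When the
reported chain is exact for `μ` (`F_* μ̃ = μ`), the right side is `2·μ(cthickening (Λ r) D)`. [folklore] -/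
theorem conjKernel_comp_ne_le_of_lipschitz [PseudoEMetricSpace Y] [OpensMeasurableSpace Y] {ι : Type*}
    [MeasurableSpace ι] [MeasurableEq ι] {D : Set Y} {Q : Y → ι} (hQm : Measurable Q)
    (hQ : ∀ y, y ∉ D → ∀ y' ∈ connectedComponentIn Dᶜ y, Q y' = Q y) (F : X ≃ᵐ Y) {Λ : ℝ≥0}
    (hF : LipschitzWith Λ F) {ρ r : ℝ}
    (hpath : ∀ x y : X, dist x y ≤ ρ → ∃ γ : ℝ → X, ContinuousOn γ (Icc (0 : ℝ) 1) ∧ γ 0 = x ∧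
      γ 1 = y ∧ ∀ t ∈ Icc (0 : ℝ) 1, dist (γ t) x ≤ r)
    (μ : Measure X) [SFinite μ] (κ : Kernel X X) [IsMarkovKernel κ] (hinv : κ.Invariant μ)
    (hstep : ∀ᵐ p ∂(μ ⊗ₘ κ), dist p.1 p.2 ≤ ρ) :
    ((μ.map F) ⊗ₘ conjKernel κ F) {q | Q q.1 ≠ Q q.2} ≤ 2 * (μ.map F) (cthickening (Λ * r) D) := by
  rw [compProd_map_conjKernel_ne κ μ F hQm,
    Measure.map_apply F.measurable isClosed_cthickening.measurableSet]
  exact compProd_comp_ne_le_of_lipschitz hQ hF hpath μ κ hinv hstep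

/-- **Intrinsic form for the reported chain**: with the SECTOR itself as the label (no charge, no
measurability of the label needed on the latent side): the reported chain changes the physical sector
with stationary one-step probability `≤ 2·(F_*μ̃)(cthickening (Λ r) D)`. [folklore] -/
theorem conjKernel_sector_ne_le_of_lipschitz [PseudoEMetricSpace Y] [OpensMeasurableSpace Y]
    {D : Set Y} (hDm : MeasurableSet {q : Y × Y | connectedComponentIn Dᶜ q.1 ≠ connectedComponentIn Dᶜ q.2})
    (F : X ≃ᵐ Y) {Λ : ℝ≥0} (hF : LipschitzWith Λ F) {ρ r : ℝ}
    (hpath : ∀ x y : X, dist x y ≤ ρ → ∃ γ : ℝ → X, ContinuousOn γ (Icc (0 : ℝ) 1) ∧ γ 0 = x ∧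
      γ 1 = y ∧ ∀ t ∈ Icc (0 : ℝ) 1, dist (γ t) x ≤ r)
    (μ : Measure X) [SFinite μ] (κ : Kernel X X) [IsMarkovKernel κ] (hinv : κ.Invariant μ)
    (hstep : ∀ᵐ p ∂(μ ⊗ₘ κ), dist p.1 p.2 ≤ ρ) :
    ((μ.map F) ⊗ₘ conjKernel κ F)
        {q | connectedComponentIn Dᶜ q.1 ≠ connectedComponentIn Dᶜ q.2} ≤
      2 * (μ.map F) (cthickening (Λ * r) D) := by
  rw [compProd_map_conjKernel κ μ F hDm, Measure.map_apply F.measurable isClosed_cthickening.measurableSet]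
  calc (μ ⊗ₘ κ) (Prod.map F F ⁻¹' {q | connectedComponentIn Dᶜ q.1 ≠ connectedComponentIn Dᶜ q.2})
      ≤ 2 * μ (cthickening r (F ⁻¹' D)) :=
        compProd_sector_apply_ne_le_two_mul_cthickening_preimage hF.continuous hpath μ κ hinv hstep
    _ ≤ 2 * μ (F ⁻¹' cthickening (Λ * r) D) := by
        gcongr 2 * ?_; exact measure_cthickening_preimage_le μ hF D r

end Reported

end Summit.Ventures.LatticeQCDFlow.Theory2.Tunnelling.Transformed

end
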